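import Literature.Computability.AlgebraicComplexity.DGIJLLiftingFrame
import Mathlib.LinearAlgebra.Matrix.Block
import HarnessLib

/-!
# DGIJL Prop. 4.12 by explicit tableaux, VI: the evaluation points

Topic `Literature/Computability/AlgebraicComplexity`; plumbing + proofs (no named facts), companion
of `DGIJLLiftingFrame.lean`. The five evaluation points `A · p` of the certificate for

* Dutta–Gesmundo–Ikenmeyer–Jindal–Lysikov, arXiv:2211.07055, **Prop. 4.12**,

are of one shape: `A = pt a₀ a₁ a₂ a₃` is the identity matrix with the row of the largest variable
`xE 0` replaced by a row supported on the four largest variables, `A (xE 0) (xE i) = aᵢ`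
(`i < 4`), zero elsewhere. Such a matrix is lower triangular with diagonal `(1, …, 1, a₀)`, so
`det A = a₀` (`det_pt`); its row `xE 1` is the unit vector of `xE 1` (`pt_apply_one`), so the
`2 × 2` minor of the tall column is `tallMinor A x y = a(x) · [y = xE 1] - a(y) · [x = xE 1]`
(`tallMinor_pt`). Design note: `run/shared/lean/pub/val-lit/bip/DGIJL-Prop412-DESIGN-p6.md`
(points `A1 = pt 1 2 0 0`, `A2 = pt 1 4 0 0`, `A3 = pt 1 4 2 0`, `A4 = pt 1 2 4 0`,
`A5 = pt 1 8 2 4`). Honest framing: plumbing for a kernel certificate of a printed theorem;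
nothing here bears on VP versus VNP.
-/

noncomputable section

open scoped BigOperators

namespace Literature.Computability.AlgebraicComplexity

namespace DGIJLLift

variable (k : ℕ)

/-- The row vector with values `a₀, a₁, a₂, a₃` at the four largest variables `xE 0, …, xE 3`
and `0` elsewhere. [cite: DuttaGesmundoIkenmeyerJindalLysikovJSC2025, Prop. 4.12] -/
def ptRow (a₀ a₁ a₂ a₃ : ℂ) (j : Fin (2 * k + 5)) : ℂ :=
  if j = xE k 0 then a₀ else if j = xE k 1 then a₁ else if j = xE k 2 then a₂
    else if j = xE k 3 then a₃ else 0

/-- **The evaluation point matrix** `pt a₀ a₁ a₂ a₃`: the identity with the row of `xE 0`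
replaced by `ptRow a₀ a₁ a₂ a₃`. [cite: DuttaGesmundoIkenmeyerJindalLysikovJSC2025, Prop. 4.12] -/
def pt (a₀ a₁ a₂ a₃ : ℂ) : Matrix (Fin (2 * k + 5)) (Fin (2 * k + 5)) ℂ :=
  Matrix.updateRow 1 (xE k 0) (ptRow k a₀ a₁ a₂ a₃)

variable {k}

/-- The enumerated variables are pairwise distinct for distinct small indices.
[cite: DuttaGesmundoIkenmeyerJindalLysikovJSC2025, Prop. 4.12] -/
theorem xE_ne {i j : ℕ} (hi : i < 2 * k + 5) (hj : j < 2 * k + 5) (h : i ≠ j) : xE k i ≠ xE k j := by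
  intro he
  have := congrArg Fin.val he
  rw [xE_val, xE_val] at this
  omega

/-- Row `xE 0` of the point is the prescribed row. [cite: DuttaGesmundoIkenmeyerJindalLysikovJSC2025, Prop. 4.12] -/
theorem pt_apply_top (a₀ a₁ a₂ a₃ : ℂ) (j : Fin (2 * k + 5)) :
    pt k a₀ a₁ a₂ a₃ (xE k 0) j = ptRow k a₀ a₁ a₂ a₃ j := by
  unfold pt
  rw [Matrix.updateRow_self]

/-- The other rows of the point are rows of the identity. [cite: DuttaGesmundoIkenmeyerJindalLysikovJSC2025, Prop. 4.12] -/
theorem pt_apply_of_ne (a₀ a₁ a₂ a₃ : ℂ) {i : Fin (2 * k + 5)} (hi : i ≠ xE k 0)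
    (j : Fin (2 * k + 5)) :
    pt k a₀ a₁ a₂ a₃ i j = (1 : Matrix (Fin (2 * k + 5)) (Fin (2 * k + 5)) ℂ) i j := by
  unfold pt
  rw [Matrix.updateRow_ne hi]

/-- Row `xE 1` of the point is the unit vector of `xE 1`.
[cite: DuttaGesmundoIkenmeyerJindalLysikovJSC2025, Prop. 4.12] -/
theorem pt_apply_one (a₀ a₁ a₂ a₃ : ℂ) (j : Fin (2 * k + 5)) :
    pt k a₀ a₁ a₂ a₃ (xE k 1) j = if j = xE k 1 then 1 else 0 := by
  rw [pt_apply_of_ne a₀ a₁ a₂ a₃ (xE_ne (by omega) (by omega) (by omega)) j, Matrix.one_apply]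
  by_cases h : j = xE k 1
  · rw [if_pos h, if_pos h.symm]
  · rw [if_neg h, if_neg (fun h' => h h'.symm)]

/-- The values of the prescribed row at the four largest variables.
[cite: DuttaGesmundoIkenmeyerJindalLysikovJSC2025, Prop. 4.12] -/
theorem ptRow_xE (a₀ a₁ a₂ a₃ : ℂ) :
    ptRow k a₀ a₁ a₂ a₃ (xE k 0) = a₀ ∧ ptRow k a₀ a₁ a₂ a₃ (xE k 1) = a₁ ∧
      ptRow k a₀ a₁ a₂ a₃ (xE k 2) = a₂ ∧ ptRow k a₀ a₁ a₂ a₃ (xE k 3) = a₃ := by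
  unfold ptRow
  refine ⟨by rw [if_pos rfl], ?_, ?_, ?_⟩
  · rw [if_neg (xE_ne (by omega) (by omega) (by omega)), if_pos rfl]
  · rw [if_neg (xE_ne (by omega) (by omega) (by omega)), if_neg (xE_ne (by omega) (by omega) (by omega)),
      if_pos rfl]
  · rw [if_neg (xE_ne (by omega) (by omega) (by omega)), if_neg (xE_ne (by omega) (by omega) (by omega)),
      if_neg (xE_ne (by omega) (by omega) (by omega)), if_pos rfl]

/-- The prescribed row vanishes off the four largest variables.
[cite: DuttaGesmundoIkenmeyerJindalLysikovJSC2025, Prop. 4.12] -/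
theorem ptRow_eq_zero (a₀ a₁ a₂ a₃ : ℂ) {j : Fin (2 * k + 5)} (h0 : j ≠ xE k 0) (h1 : j ≠ xE k 1)
    (h2 : j ≠ xE k 2) (h3 : j ≠ xE k 3) : ptRow k a₀ a₁ a₂ a₃ j = 0 := by
  unfold ptRow
  rw [if_neg h0, if_neg h1, if_neg h2, if_neg h3]

/-- **The point matrix is lower triangular with diagonal `(1, …, 1, a₀)`, so `det (pt a₀ …) = a₀`.**
[cite: DuttaGesmundoIkenmeyerJindalLysikovJSC2025, Prop. 4.12] -/
theorem det_pt (a₀ a₁ a₂ a₃ : ℂ) : (pt k a₀ a₁ a₂ a₃).det = a₀ := by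
  have htri : (pt k a₀ a₁ a₂ a₃).BlockTriangular OrderDual.toDual := by
    intro i j hij
    change j > i at hij
    by_cases hi : i = xE k 0
    · -- the replaced row is the last row: no `j > xE 0`
      exfalso
      have h1 : (j : ℕ) < 2 * k + 5 := j.2
      have h2 : (i : ℕ) = 2 * k + 4 := by rw [hi, xE_val]; omega
      have h3 : (i : ℕ) < (j : ℕ) := hij
      omega
    · rw [pt_apply_of_ne a₀ a₁ a₂ a₃ hi, Matrix.one_apply, if_neg (ne_of_lt hij)]
  rw [Matrix.det_of_lowerTriangular _ htri]
  rw [Fintype.prod_eq_single (xE k 0) (fun i hi => by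
    rw [pt_apply_of_ne a₀ a₁ a₂ a₃ hi, Matrix.one_apply_eq])]
  rw [pt_apply_top, (ptRow_xE a₀ a₁ a₂ a₃).1]

/-- **The `2 × 2` minor of the tall column at a point**: with row `xE 1` a unit vector,
`tallMinor (pt a) x y = a(x) · [y = xE 1] - a(y) · [x = xE 1]`.
[cite: DuttaGesmundoIkenmeyerJindalLysikovJSC2025, Prop. 4.12] -/
theorem tallMinor_pt (a₀ a₁ a₂ a₃ : ℂ) (x y : Fin (2 * k + 5)) :
    tallMinor k (pt k a₀ a₁ a₂ a₃) x y =
      ptRow k a₀ a₁ a₂ a₃ x * (if y = xE k 1 then 1 else 0) -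
        ptRow k a₀ a₁ a₂ a₃ y * (if x = xE k 1 then 1 else 0) := by
  unfold tallMinor
  rw [pt_apply_top, pt_apply_top, pt_apply_one, pt_apply_one]

/-- The entries of row `xE 0` used by the singleton factors. [cite: DuttaGesmundoIkenmeyerJindalLysikovJSC2025, Prop. 4.12] -/
theorem pt_top_eq_ptRow (a₀ a₁ a₂ a₃ : ℂ) :
    (fun j => pt k a₀ a₁ a₂ a₃ (xE k 0) j) = ptRow k a₀ a₁ a₂ a₃ := by
  funext j
  exact pt_apply_top a₀ a₁ a₂ a₃ j

end DGIJLLift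

end Literature.Computability.AlgebraicComplexity

end
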